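import Literature.NumberTheory.Automorphic.PairLFunctionBoundaryProofs
import Literature.NumberTheory.Automorphic.PairLFunctionNeConjOrthogonalLocalReduction
import HarnessLib

/-!
# Sketch — crux `PairLBoundaryJS` (stmt-Langlands-13622), crux-ideate round 1, ideator 2

First lemmas of the two idea cards, stated over existing declarations (not proved here):

* card `mirabolic-descent-nonvanishing` (lever A): `baseCase_nonorthogonal` (the `k = 1` step of the
  mirabolic descent, Mathlib only), `MirabolicDescentBoundaryDatum` (the conclusion of the descent in the
  tree's vocabulary: ONE datum whose `S'`-part is continuous on the closed half-plane at `s₀` and non-zero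
  there) and `continuousOn_line_of_boundaryDatum` (the Jacquet–Shalika half of (2.2) from it and the tree's
  global Rankin–Selberg theorems).
* card `unitary-axis-eisenstein` (lever B): `ne_zero_of_tendsto_inv` (proved), `ReciprocalBoundaryValues`
  (the interface the Eisenstein series deliver: `1/L^S` has finite boundary values from the right),
  `shahidi_of_reciprocalBoundaryValues` (proved: it implies the tree's Shahidi half
  `Shahidi1980_partialPairL_boundaryValue_ne_zero`, restated verbatim as `ShahidiHalf`), `EisensteinWhittakerIdentity` (the shape of Shahidi's
  identity `E_ψ(s) = c_S(s) / L^S(1 + s, π × σ)` with `E_ψ`, `c_S` continuous up to the unitary axis and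
  `c_S(it) ≠ 0`) and `reciprocalBoundaryValues_of_eisenstein`.
-/

noncomputable section

open MeasureTheory Measure NumberField IsDedekindDomain Matrix Set Filter Topology
open scoped ENNReal NNReal ComplexConjugate InnerProductSpace

-- `Summit.Langlands.Langlands.…` (summit = sub-problem name, D-0017 layout) trips `dupNamespace`
set_option linter.dupNamespace false

namespace Summit.Langlands.Langlands.Cruxes.PairLBoundaryJS.Sketch

open Literature.NumberTheory.Automorphic
open Literature.NumberTheory.GaloisRepresentations (ideleGroup)

/-! ## Lever A — mirabolic descent -/

/-- **Base case (`k = 1`) of the mirabolic descent.** Over a locally compact non-discrete normed field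
`F` with a non-trivial continuous additive character `ψ`: a non-zero space `A` of continuous
square-integrable functions stable under dilations `x ↦ x t` (`t ≠ 0`) and under multiplication by the
characters `x ↦ ψ(c x)` is never orthogonal to a non-zero continuous square-integrable function.
(Fourier uniqueness for finite measures on `F` kills `a · conj a'`; dilation stability then kills `a'`.)
The level-`k` statement replaces `F` by `N_k \ GL_k(F)` (last-row fibration), dilations by right
translations and `ψ(c x)` by the characters of the last row coming from the column unipotents. -/
theorem baseCase_nonorthogonal {F : Type*} [NontriviallyNormedField F] [LocallyCompactSpace F]
    [MeasurableSpace F] [BorelSpace F] (μ : Measure F) [μ.IsAddHaarMeasure]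
    (ψ : AddChar F Circle) (_hψ : Continuous ψ) (_hψ1 : ψ ≠ 1)
    (A : Submodule ℂ (F → ℂ))
    (_hAc : ∀ a ∈ A, Continuous a ∧ MemLp a 2 μ)
    (_hAt : ∀ a ∈ A, ∀ t : F, t ≠ 0 → (fun x => a (x * t)) ∈ A)
    (_hAm : ∀ a ∈ A, ∀ c : F, (fun x => ((ψ (c * x) : ℂ)) * a x) ∈ A)
    (_hA0 : A ≠ ⊥) (a' : F → ℂ) (_ha'c : Continuous a') (_ha'2 : MemLp a' 2 μ) (_ha'0 : a' ≠ 0) :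
    ∃ a ∈ A, ∫ x, a x * conj (a' x) ∂μ ≠ 0 := by
  sorry

-- the automorphic quotient carries the tree's Borel σ-algebra, not Mathlib's quotient σ-algebra
attribute [-instance] Quotient.instMeasurableSpace QuotientGroup.measurableSpace

section TreeVocabulary

open ValuativeRel

variable {n : ℕ} {K : Type} [Field K] [NumberField K]
variable {μ' : Measure (AdelicGroupData.gl n K).automorphicQuotient} [(AdelicGroupData.gl n K).IsAutomorphicMeasure μ']
variable [MeasurableSpace (AdeleRing (𝓞 K) K)] [BorelSpace (AdeleRing (𝓞 K) K)]

-- the house local instances, exactly as in `RankinSelbergUnfoldingIdentity`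
attribute [local instance] adelicBorel borelSpace_adelic locallyCompactSpace_adelic secondCountableTopology_gl_adelic
  glAdeleBorel borelSpace_glAdele borelSpace_ideleGroup secondCountableTopology_ideleGroup

variable (n K μ') in
/-- **The conclusion of the mirabolic descent, in the tree's vocabulary (lever A).** For cuspidal `π`,
`σ'` in `L²_cusp(GL_n, μ')` with a common central action, a finite `S₀` with Satake families off it,
and a boundary point `s₀`, `Re s₀ = 1`: ONE datum `(f, f', η, S', Φ_∞)` of the global Rankin–Selberg
method whose `S'`-part `Ψ_{S'}(s)` (the unit-box integral of `PairLFunctionNeConjGlobalRankinSelberg`) is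
continuous on the closed half-plane `{1 ≤ Re s}` at `s₀` and does **not vanish at `s₀`**. Absolute
convergence on `Re s ≥ 1` is the (2.3) thin-moment leaf (`θ_v < 1/2`); the non-vanishing is the descent. -/
def MirabolicDescentBoundaryDatum : Prop :=
  ∀ (_hn : 0 < n)
    (νA : Measure (Fin n → ideleGroup K)) [IsHaarMeasure νA]
    (νK : Measure ↥(maximalCompactAdelic n K)) [IsHaarMeasure νK]
    (ν₀ : Measure ↥(adelicUnipotent n K)) [IsHaarMeasure ν₀]
    (P P' : CuspidalAutomorphicRepGL n K μ')
    (_hω : ∀ z : ideleGroup K, ∃ c : ℂ, ‖c‖ = 1 ∧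
        (∀ f : P.1.toSubmodule,
          (AdelicGroupData.gl n K).rightRegular μ' (Matrix.GeneralLinearGroup.scalar (Fin n) z)
              (f : (AdelicGroupData.gl n K).L2 μ') = c • (f : (AdelicGroupData.gl n K).L2 μ')) ∧
        (∀ f' : P'.conj.1.toSubmodule,
          (AdelicGroupData.gl n K).rightRegular μ' (Matrix.GeneralLinearGroup.scalar (Fin n) z)
              (f' : (AdelicGroupData.gl n K).L2 μ') = c • (f' : (AdelicGroupData.gl n K).L2 μ')))
    {S₀ : Set (HeightOneSpectrum (𝓞 K))} (_hS₀ : S₀.Finite)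
    (s₀ : ℂ) (_hs₀ : s₀.re = 1),
    ∃ (f : P.1.toSubmodule) (f' : P'.conj.1.toSubmodule)
      (𝔫₀ : Ideal (𝓞 K)) (_h𝔫₀ : 𝔫₀ ≠ 0)
      (η : (AdelicGroupData.gl n K).Adelic → ℝ) (_hη : IsTestFunctionGL n K η)
      (_hηK : ∀ k : (AdelicGroupData.gl n K).Adelic, k ∈ principalCongruenceLevel n K 𝔫₀ →
        ∀ g : (AdelicGroupData.gl n K).Adelic, η (k * g) = η g)
      (S' : Set (HeightOneSpectrum (𝓞 K))) (_hS'f : (S' \ S₀).Finite) (_hS₀S' : S₀ ⊆ S')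
      (_hS' : ∀ v ∉ S', ¬ v.asIdeal ∣ 𝔫₀ ∧ ¬ v.asIdeal ∣ differentIdeal ℤ (𝓞 K))
      (Φinf : (Fin n → InfiniteAdeleRing K) → ℝ) (_hΦc : Continuous Φinf) (_hΦ0 : ∀ z, 0 ≤ Φinf z)
      (_hΦS : (fun v => ((standardTestFun n K Φinf v : ℝ) : ℂ)) ∈ piSchwartzBruhat K (Fin n)),
      let Ψ : ℂ → ℂ := fun s =>
        ∫ p in unitBox {v | v ∉ S'} ×ˢ Set.univ, torusPairIntegrandC n K
          (whittakerCoeff ν₀ (unipotentTateDomain n K) (adeleAddChar K)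
            (invQuot (AdelicGroupData.gl n K) (smoothedForm η ((f : P.1.toSubmodule) : (AdelicGroupData.gl n K).L2 μ'))))
          (star (whittakerCoeff ν₀ (unipotentTateDomain n K) (adeleAddChar K)
            (invQuot (AdelicGroupData.gl n K) (smoothedForm η ((f' : P'.conj.1.toSubmodule) : (AdelicGroupData.gl n K).L2 μ')))))
          (standardTestFun n K Φinf) s p ∂(νA.prod νK)
      Ψ s₀ ≠ 0 ∧ ContinuousWithinAt Ψ {s : ℂ | 1 ≤ s.re} s₀

/-- **The Jacquet–Shalika half of (2.2) for orthogonal pairs, from the descent datum (lever A).**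
Same rank, one `L²_cusp`, `π ⟂ σ̄` (the Schur form of "`s₀ ∉ X`"): `L^S(s, π ⊗ σ)` extends continuously
to the closed half-plane `{1 ≤ Re s}` — from `MirabolicDescentBoundaryDatum` and the tree's GLOBAL theorems
only (`exists_entire_eq_mul_partialPairL_mul_setIntegral_pair`: `F = s (s-1) C L^{S'} Ψ_{S'}` entire,
`F(1) = 0` by orthogonality; divide by `Ψ_{S'}` near each boundary point, patch, change `S`). No
Mœglin–Waldspurger fact, no local Whittaker/Kirillov theory, no multiplicity one. -/
theorem continuousOn_line_of_boundaryDatum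
    (hA : MirabolicDescentBoundaryDatum n K μ')
    (hn : 0 < n) (P P' : CuspidalAutomorphicRepGL n K μ')
    (_hor : P.1.toSubmodule ⟂ P'.conj.1.toSubmodule)
    {S : Set (HeightOneSpectrum (𝓞 K))} (hS : S.Finite)
    {α β : SatakeFamily K} (hα : IsSatakeFamilyOf P S α) (hβ : IsSatakeFamilyOf P' S β) :
    ∃ g : ℂ → ℂ, ContinuousOn g {s : ℂ | 1 ≤ s.re} ∧
      Set.EqOn g (partialPairL S α β) {s : ℂ | 1 < s.re} := by
  sorry

end TreeVocabulary

/-! ## Lever B — boundary values of `1/L^S` from the unitary axis of an Eisenstein series -/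

/-- **Glue (proved).** If `L ≠ 0` eventually along a filter, `L⁻¹ → ℓ` (finite) and `L → c`, then `c ≠ 0`. -/
theorem ne_zero_of_tendsto_inv {l : Filter ℂ} [l.NeBot] {L : ℂ → ℂ} {ℓ c : ℂ}
    (h0 : ∀ᶠ s in l, L s ≠ 0) (hinv : Tendsto (fun s => (L s)⁻¹) l (𝓝 ℓ))
    (hc : Tendsto L l (𝓝 c)) : c ≠ 0 := by
  rintro rfl
  have h1 : Tendsto (fun s => L s * (L s)⁻¹) l (𝓝 (0 * ℓ)) := hc.mul hinv
  have h2 : Tendsto (fun s => L s * (L s)⁻¹) l (𝓝 1) :=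
    tendsto_const_nhds.congr' (h0.mono fun s hs => (mul_inv_cancel₀ hs).symm)
  have h := tendsto_nhds_unique h1 h2
  simp at h

section Eisenstein

open AdelicGroupData

variable {n m : ℕ} {K : Type} [Field K] [NumberField K]
  {μ : Measure (gl n K).automorphicQuotient} [(gl n K).IsAutomorphicMeasure μ]
  {μ' : Measure (gl m K).automorphicQuotient} [(gl m K).IsAutomorphicMeasure μ']

variable (n m K μ μ') in
/-- **Shahidi's half of (2.2)** — VERBATIM the named fact
`Literature.NumberTheory.Automorphic.Shahidi1980_partialPairL_boundaryValue_ne_zero` of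
`PairLFunctionBoundaryHalves` (landed 2026-08-16T07:21Z; restated here only because that module is not
yet built on the farm at sketch time; the two are `Iff.rfl`). -/
def ShahidiHalf : Prop :=
  ∀ (_hn : 0 < n) (_hm : 0 < m) (P : CuspidalAutomorphicRepGL n K μ)
    (P' : CuspidalAutomorphicRepGL m K μ') {S : Set (HeightOneSpectrum (𝓞 K))} (_hS : S.Finite)
    {α β : SatakeFamily K} (_hα : IsSatakeFamilyOf P S α) (_hβ : IsSatakeFamilyOf P' S β)
    (t : ℝ) {c : ℂ}
    (_hc : Tendsto (partialPairL S α β) (𝓝[{s : ℂ | 1 < s.re}] (1 + t * Complex.I)) (𝓝 c)),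
    c ≠ 0

variable (n m K μ μ') in
/-- **The interface the Eisenstein series deliver (lever B):** the reciprocal partial `L`-function
`1 / L^S(s, π ⊗ σ)` has a FINITE boundary value at every `1 + it` from `Re s > 1`. -/
def ReciprocalBoundaryValues : Prop :=
  ∀ (_hn : 0 < n) (_hm : 0 < m) (P : CuspidalAutomorphicRepGL n K μ)
    (P' : CuspidalAutomorphicRepGL m K μ') {S : Set (HeightOneSpectrum (𝓞 K))} (_hS : S.Finite)
    {α β : SatakeFamily K} (_hα : IsSatakeFamilyOf P S α) (_hβ : IsSatakeFamilyOf P' S β) (t : ℝ),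
    ∃ ℓ : ℂ, Tendsto (fun s => (partialPairL S α β s)⁻¹)
      (𝓝[{s : ℂ | 1 < s.re}] (1 + t * Complex.I)) (𝓝 ℓ)

/-- **Shahidi's half from finite boundary values of `1/L^S` (proved).** Together with the non-vanishing
of the convergent Euler product on `Re s > 1` ((2.1)), `ReciprocalBoundaryValues` gives the tree's named
fact `Shahidi1980_partialPairL_boundaryValue_ne_zero` verbatim. -/
theorem shahidi_of_reciprocalBoundaryValues
    (h : ReciprocalBoundaryValues n m K μ μ')
    (hL0 : ∀ (P : CuspidalAutomorphicRepGL n K μ) (P' : CuspidalAutomorphicRepGL m K μ')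
      {S : Set (HeightOneSpectrum (𝓞 K))} (_hS : S.Finite) {α β : SatakeFamily K}
      (_hα : IsSatakeFamilyOf P S α) (_hβ : IsSatakeFamilyOf P' S β) (s : ℂ), 1 < s.re →
      partialPairL S α β s ≠ 0) :
    ShahidiHalf n m K μ μ' := by
  intro hn hm P P' S hS α β hα hβ t c hc
  obtain ⟨ℓ, hℓ⟩ := h hn hm P P' hS hα hβ t
  have hmem : (1 + (t : ℂ) * Complex.I) ∈ closure {s : ℂ | 1 < s.re} := by
    rw [Complex.closure_setOf_lt_re]
    simp
  haveI : (𝓝[{s : ℂ | 1 < s.re}] (1 + (t : ℂ) * Complex.I)).NeBot :=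
    mem_closure_iff_nhdsWithin_neBot.mp hmem
  have h0 : ∀ᶠ s in 𝓝[{s : ℂ | 1 < s.re}] (1 + (t : ℂ) * Complex.I), partialPairL S α β s ≠ 0 :=
    eventually_nhdsWithin_of_forall fun s hs => hL0 P P' hS hα hβ s hs
  exact ne_zero_of_tendsto_inv h0 hℓ hc

variable (n m K μ μ') in
/-- **The shape of Shahidi's identity (lever B, what the Eisenstein package must deliver).** For the
data of `ReciprocalBoundaryValues` and real `t` there are `c` (the product of the local big-cell Jacquet
integrals at `S ∪ S_∞`, chosen non-zero at `it`) and `E` (the `ψ`-Whittaker coefficient at `e` of the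
cuspidal-data Eisenstein series on `GL_{n+m}`, holomorphic — here: continuous from the right — at the
unitary point `it`) with `E(s) = c(s) / L^S(1 + s, π ⊗ σ)` on `Re s > 0` (unramified computation:
Casselman–Shalika / Jacquet integral in stages). -/
def EisensteinWhittakerIdentity : Prop :=
  ∀ (_hn : 0 < n) (_hm : 0 < m) (P : CuspidalAutomorphicRepGL n K μ)
    (P' : CuspidalAutomorphicRepGL m K μ') {S : Set (HeightOneSpectrum (𝓞 K))} (_hS : S.Finite)
    {α β : SatakeFamily K} (_hα : IsSatakeFamilyOf P S α) (_hβ : IsSatakeFamilyOf P' S β) (t : ℝ),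
    ∃ (c E : ℂ → ℂ),
      ContinuousWithinAt c {s : ℂ | 0 ≤ s.re} (t * Complex.I) ∧ c (t * Complex.I) ≠ 0 ∧
      ContinuousWithinAt E {s : ℂ | 0 ≤ s.re} (t * Complex.I) ∧
      ∀ s : ℂ, 0 < s.re → E s = c s * (partialPairL S α β (1 + s))⁻¹

/-- **`1/L^S` has finite boundary values from Shahidi's identity (lever B, first lemma).**
`ℓ = E(it) / c(it)` after the change of variable `s ↦ s - 1`. -/
theorem reciprocalBoundaryValues_of_eisenstein
    (h : EisensteinWhittakerIdentity n m K μ μ') : ReciprocalBoundaryValues n m K μ μ' := by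
  sorry

end Eisenstein

end Summit.Langlands.Langlands.Cruxes.PairLBoundaryJS.Sketch

end
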